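import Summits.BirchSwinnertonDyer.Rank1Residual.X5.TwoAdicTargetsTowerGap
import Summits.BirchSwinnertonDyer.Rank1Residual.X5.TwoAdicTargetsAlphaEnd
import Literature.NumberTheory.EllipticCurves.IwasawaOrderKernelRankProofs
import Literature.NumberTheory.EllipticCurves.IwasawaAlgebraProofs
import Literature.NumberTheory.EllipticCurves.IwasawaSelmerModuleFiniteProofs
import HarnessLib

/-!
# Class O1 (X5, `p = 2`, non-CM): the TOWER-GAP lemma, part 2 — `X/pX` finite ⇒ `X` torsion and
# `μ = 0` (any prime, PROVED); T10/U10: the tower-gap certificate ⇒ `MissingUpperBoundAt W 2`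

HONEST FRAMING (cell `b2b-bsdres`, run/shared/lean/b2b/bsd-rank1-residual/, verbatim in every
file): the goal of the cell is to DELETE the COMBINATION-SHAPED residual classes of the
Birch–Swinnerton-Dyer formula for ALL analytic-rank `≤ 1` elliptic curves over `ℚ` — "full BSD
formula for every rank `≤ 1` curve in class `C`" assembled STRICTLY from published theorems — so
that the rank-`≤ 1` remainder becomes exactly the CONSTRUCTION-SHAPED classes, which are TYPED
(missing-input `Prop`s), NOT attempted. This is not "finishing BSD". Research routes; no claim
beyond stated classes; census output = EVIDENCE, never a Literature fact; nothing here is booked;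
no mark of RESIDUAL-MAP §I moves.

Unit `b2b-bsdres-cc-typer-4` (lane CLASS-CLOSURE, class O1), gen 3; o1 lead PLAN v2.5 C40/C43/C44
(queue item (2′), lens-3 L3-10 `TowerGapMuCertificateAtTwo`). Continues
`X5/TwoAdicTargetsTowerGap.lean` (the gap lemma: one gap ⇒ `X/pX` finite). Theorems, plus ONE typed
certificate predicate (`O1.TowerGapAtTwo`, Summits-side, a per-curve computational hypothesis,
nothing asserted); 0 named facts.

## Part A.5 (namespace `…X5.TowerGap`, any prime `p`)

* **`X/pX` finite ⇒ `X` finitely generated over `ℤ_p`** for `X` finitely generated over `Λ`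
  (`moduleFinite_padicInt_of_finite_modP`): Matsumura Thm. 8.4 over the `p`-adically complete `ℤ_p`
  (tree theorem `Literature.AlgebraicGeometry.Resolution.Matsumura1987_8_4_finset`) with `p`-adic
  separatedness of `X` from Krull's intersection theorem over the local ring `Λ` (Mathlib
  `IsHausdorff.of_isLocalRing`, `p ∈ 𝔪_Λ`). Washington §13.2's "Nakayama for compact `Λ`-modules"
  in algebraic dress.
* **⇒ `X` is `Λ`-torsion and `μ(X) = 0`** (`isTorsion_and_mu_eq_zero_of_finite_modP`; tree
  `IwasawaAlgebra.isTorsion_of_finite_baseChange`, `muInvariant_eq_zero_iff_finite`), and the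
  one-line certificate form **`isTorsion_and_mu_eq_zero_of_card_quotient_lt`**:
  `#(X/(p,T^{m+k})X) < p^k · #(X/(p,T^m)X) ⇒ X` torsion `∧ μ(X) = 0` — T10's algebraic half, any `p`.

## Part B — the O1 consumer (namespace `…X5.O1`, `p = 2`)

* `O1.TowerGapAtTwo W` — K10 at the X-LEVEL: for every cyclotomic datum `(κ, γ, D)` there are
  `m, k` with `#(X/(2,T^{m+k})X) < 2^k · #(X/(2,T^m)X)`, `X = D.X = X(E/ℚ_∞)` (both quotients finite,
  `finite_quotient_towerIdeal`; lens-3 takes `m = k = 2ⁿ`, `n ≤ 2`, where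
  `#X/(2, T^{2ⁿ})X = #X/(2, ω_n)X = 2^{d_n(E)}`). A per-curve COMPUTATIONAL hypothesis — certificate /
  instrument tier: the P10 job computes `d_n(E) = dim_{𝔽₂} S_n^{Gr}(E)`; the support S-G4.0
  `exactLayerDescentAtTwo` identifying `S_n^{Gr}(E)` with the dual of `(X/2X)/ω_n` is RESERVED (PLAN
  C44 (11)) and NOT typed here; EVIDENCE-carried per pair, never a Literature fact; nothing asserted.
* **`isTorsion_and_mu_eq_zero_of_towerGapAtTwo` (T10, PROVED)**: `TowerGapAtTwo W ⇒` for every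
  cyclotomic datum, `X(E/ℚ_∞)` is `Λ`-torsion and `μ₂ = 0` (`X` finitely generated for an elliptic
  curve: `module_finite_holds`). No reduction / image hypothesis.
* **`missingUpperBoundAt_two_of_towerGap` (U10, PROVED)**: rank `0` ∧ `GoodOrd W 2`,
  `TowerGapAtTwo W` + the Néron-integrality certificate `hint` (`ϖ · L₂(f, α) ∈ Λ`) ⇒
  `MissingUpperBoundAt W 2` (SHARP), modulo the PUBLISHED inputs as hypotheses — Greenberg 4.1@2
  (`hEC`), modularity, GZK, Kato 17.4 (1)(2)@2 (`h17`) — via `missingUpperBoundAt_two_of_mu_eq_zero`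
  (`X5/TwoAdicTargetsAlphaEnd.lean`). No image hypothesis, no period-unit input, no slack, no
  Cassels–Tate.
* **`bsdp_two_of_towerGap_of_lowerBound` (PROVED)**: `… ∧ MissingLowerBoundAt W 2 ⇒ BSDp W 2` — the
  residue-PAIR pipeline of PLAN C43 (P1) with NO research crux (tower-gap certificate ∧ ENGINE-I
  lower-bound certificate ∧ `hint`, all per pair). What it does NOT buy: a class theorem (K10 is per
  curve; reach = the P10 job's answer), nothing on O1-B/C.
* `charIdeal_dvd_of_towerGap`: the certificate also feeds the refuter's upgrade at `k = 0`
  (`char_Λ X ∣ ϖ′ · L₂(f, α)` given Kato 17.4 (1)(2)@2 and an integral normaliser).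

References: L. Washington, *Introduction to Cyclotomic Fields*, §13.2; H. Matsumura, *Commutative
Ring Theory*, Thm. 8.4; R. Greenberg, LNM 1716 (1999), §1 (Conj. 1.11; after Thm. 1.3: `X` finitely
generated), Thm. 4.1 (p. 102); R. Greenberg, V. Vatsal, Invent. Math. 142 (2000), Prop. (2.8);
K. Kato, Astérisque 295 (2004), Thm. 17.4 (p. 273); R. L. Miller, LMS J. Comput. Math. 14 (2011),
Def. 1.1.
-/

set_option autoImplicit false

noncomputable section

open scoped Classical MatrixGroups ModularForm Pointwise

open CongruenceSubgroup WeierstrassCurve Literature.NumberTheory.EllipticCurves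
  Literature.NumberTheory.EllipticCurves.ModularForms
  Literature.NumberTheory.EllipticCurves.Wuthrich2014
  Literature.NumberTheory.EllipticCurves.Rank1Residual
  Literature.NumberTheory.EllipticCurves.Rank1Residual.Typed
  Literature.NumberTheory.EllipticCurves.Greenberg1999
  IsLocalRing

/-! ## Part A.5 — `X/pX` finite ⇒ `X` finitely generated over `ℤ_p` ⇒ torsion and `μ = 0` -/

namespace Summit.BirchSwinnertonDyer.Rank1Residual.X5.TowerGap

variable (p : ℕ) [hp : Fact p.Prime] {M : Type*} [AddCommGroup M] [Module (IwasawaAlgebra p) M]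

section PadicInt

variable [Module ℤ_[p] M] [IsScalarTower ℤ_[p] (IwasawaAlgebra p) M]

/-- `c • x = C(c) • x` for the compatible `ℤ_p`-structure. [folklore] -/
theorem padicInt_smul_eq_C_smul (c : ℤ_[p]) (x : M) :
    c • x = (PowerSeries.C c : IwasawaAlgebra p) • x := by
  rw [PowerSeries.C_eq_algebraMap, algebraMap_smul]

/-- `pⁿX` as a `ℤ_p`-submodule is `(p)ⁿ • X` as a `Λ`-submodule (same underlying set). [folklore] -/
theorem mem_maximalIdeal_pow_smul_top_iff (n : ℕ) (x : M) :
    x ∈ (maximalIdeal ℤ_[p] ^ n • ⊤ : Submodule ℤ_[p] M) ↔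
      x ∈ (Ideal.span {(PowerSeries.C (p : ℤ_[p]) : IwasawaAlgebra p)} ^ n • ⊤ :
        Submodule (IwasawaAlgebra p) M) := by
  rw [PadicInt.maximalIdeal_eq_span_p, Ideal.span_singleton_pow, Ideal.span_singleton_pow,
    Submodule.ideal_span_singleton_smul, Submodule.ideal_span_singleton_smul,
    Submodule.mem_smul_pointwise_iff_exists, Submodule.mem_smul_pointwise_iff_exists]
  constructor
  · rintro ⟨y, -, rfl⟩
    exact ⟨y, Submodule.mem_top, by rw [padicInt_smul_eq_C_smul, map_pow]⟩
  · rintro ⟨y, -, rfl⟩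
    exact ⟨y, Submodule.mem_top, by rw [padicInt_smul_eq_C_smul, map_pow]⟩

/-- **`X/pX` finite ⇒ `X` is finitely generated over `ℤ_p`** for `X` finitely generated over `Λ`
(Matsumura Thm. 8.4 over the `p`-adically complete `ℤ_p`; `X` is `p`-adically separated by
Krull's intersection theorem over the local ring `Λ`, `p ∈ 𝔪_Λ`). Washington §13.2 (Lemma 13.16
/ Nakayama for compact `Λ`-modules), here in its algebraic form. [cite: Matsumura1987, Thm. 8.4]
[cite: Washington1997, §13.2] -/
theorem moduleFinite_padicInt_of_finite_modP [Module.Finite (IwasawaAlgebra p) M]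
    (hfin : Finite (M ⧸ modPSubmodule p M)) : Module.Finite ℤ_[p] M := by
  set I := maximalIdeal ℤ_[p] with hI
  -- `p`-adic separatedness, transported from `Λ`
  have hne : Ideal.span {(PowerSeries.C (p : ℤ_[p]) : IwasawaAlgebra p)} ≠ ⊤ := fun h =>
    (Ideal.span_singleton_eq_top.mp h |> fun hu =>
      (mem_maximalIdeal _).mp (IwasawaAlgebra.C_p_mem_maximalIdeal p) hu)
  haveI hH : IsHausdorff (Ideal.span {(PowerSeries.C (p : ℤ_[p]) : IwasawaAlgebra p)}) M :=
    IsHausdorff.of_isLocalRing _ M hne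
  haveI : IsHausdorff I M := by
    refine ⟨fun x hx => IsHausdorff.haus hH x fun n => ?_⟩
    have hxn := hx n
    rw [SModEq.zero] at hxn ⊢
    exact (mem_maximalIdeal_pow_smul_top_iff p n x).mp hxn
  -- representatives of `M/pM`
  obtain ⟨T, hT⟩ : ∃ T : Finset M, ∀ x : M, ∃ t ∈ T, x - t ∈ modPSubmodule p M := by
    haveI := Fintype.ofFinite (M ⧸ modPSubmodule p M)
    refine ⟨Finset.univ.image fun q : M ⧸ modPSubmodule p M =>
      (Submodule.Quotient.mk_surjective _ q).choose, fun x => ?_⟩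
    refine ⟨(Submodule.Quotient.mk_surjective (modPSubmodule p M)
        (Submodule.Quotient.mk x)).choose, Finset.mem_image_of_mem _ (Finset.mem_univ _), ?_⟩
    have h := (Submodule.Quotient.mk_surjective (modPSubmodule p M)
      (Submodule.Quotient.mk x)).choose_spec
    exact (Submodule.Quotient.eq _).mp h.symm
  have hsup : Submodule.span ℤ_[p] (T : Set M) ⊔ (I • ⊤ : Submodule ℤ_[p] M) = ⊤ := by
    refine Submodule.eq_top_iff'.mpr fun x => ?_
    obtain ⟨t, ht, hxt⟩ := hT x
    rw [show x = t + (x - t) by abel]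
    refine Submodule.add_mem_sup (Submodule.subset_span ht) ?_
    have h1 : x - t ∈ (maximalIdeal ℤ_[p] ^ 1 • ⊤ : Submodule ℤ_[p] M) := by
      rw [mem_maximalIdeal_pow_smul_top_iff p 1, pow_one]
      exact hxt
    simpa [hI] using h1
  exact ⟨⟨T, Literature.AlgebraicGeometry.Resolution.Matsumura1987_8_4_finset I T hsup⟩⟩

/-- **`X/pX` finite ⇒ `X` is `Λ`-torsion and `μ(X) = 0`** for `X` finitely generated over `Λ`
with its compatible `ℤ_p`-structure (f.g. over `ℤ_p` ⇒ `dim ℚ_p ⊗ X < ∞` ⇒ torsion, tree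
`IwasawaAlgebra.isTorsion_of_finite_baseChange`; `μ = 0 ⟺` f.g. over `ℤ_p` for f.g. torsion `X`,
tree `muInvariant_eq_zero_iff_finite`). Greenberg–Vatsal 2000 Prop. (2.8) shape ("`Λ`-cotorsion
and `μ = 0` iff `S[π]` finite"), Washington §13.2. [cite: Washington1997, §13.2]
[cite: GreenbergVatsal2000, §2 Prop. (2.8) (p. 25)] -/
theorem isTorsion_and_mu_eq_zero_of_finite_modP' [Module.Finite (IwasawaAlgebra p) M]
    (hfin : Finite (M ⧸ modPSubmodule p M)) :
    Module.IsTorsion (IwasawaAlgebra p) M ∧ muInvariant p M = 0 := by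
  haveI : Module.Finite ℤ_[p] M := moduleFinite_padicInt_of_finite_modP p hfin
  have hT : Module.IsTorsion (IwasawaAlgebra p) M :=
    IwasawaAlgebra.isTorsion_of_finite_baseChange p (M := M)
  exact ⟨hT, (muInvariant_eq_zero_iff_finite p M hT).mpr ‹_›⟩

end PadicInt

/-- **`X/pX` finite ⇒ `X` is `Λ`-torsion and `μ(X) = 0`** for any finitely generated `Λ`-module
(the `ℤ_p`-structure is the restricted one, `Module.compHom`). [cite: Washington1997, §13.2] -/
theorem isTorsion_and_mu_eq_zero_of_finite_modP {M : Type*} [AddCommGroup M]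
    [Module (IwasawaAlgebra p) M] [Module.Finite (IwasawaAlgebra p) M]
    (hfin : Finite (M ⧸ modPSubmodule p M)) :
    Module.IsTorsion (IwasawaAlgebra p) M ∧ muInvariant p M = 0 := by
  letI : Module ℤ_[p] M := Module.compHom M (algebraMap ℤ_[p] (IwasawaAlgebra p))
  haveI : IsScalarTower ℤ_[p] (IwasawaAlgebra p) M := IsScalarTower.of_compHom ℤ_[p] _ M
  exact isTorsion_and_mu_eq_zero_of_finite_modP' p hfin

/-- **T10, algebraic half, any prime (PROVED): ONE tower gap certifies torsion and `μ = 0`.**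
For `X` finitely generated over `Λ = ℤ_p⟦T⟧` and `m k : ℕ`:
`#(X/(p,T^{m+k})X) < p^k · #(X/(p,T^m)X) ⇒ X` is `Λ`-torsion and `μ(X) = 0`. With
`(p, T^{pⁿ}) = (p, ω_n)` (`span_C_p_sup_span_omega_eq_towerIdeal`) and `m = k = pⁿ` this is
lens-3's "`d_{n+1} − d_n < 2ⁿ` (in `log_p` of cardinalities) `⇒ X` torsion `∧ μ = 0`".
[cite: Washington1997, §13.2] [cite: Matsumura1987, Thm. 8.4] -/
theorem isTorsion_and_mu_eq_zero_of_card_quotient_lt {M : Type*} [AddCommGroup M]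
    [Module (IwasawaAlgebra p) M] [Module.Finite (IwasawaAlgebra p) M] (m k : ℕ)
    (hlt : Nat.card (M ⧸ (towerIdeal p (m + k) • ⊤ : Submodule (IwasawaAlgebra p) M)) <
      p ^ k * Nat.card (M ⧸ (towerIdeal p m • ⊤ : Submodule (IwasawaAlgebra p) M))) :
    Module.IsTorsion (IwasawaAlgebra p) M ∧ muInvariant p M = 0 :=
  isTorsion_and_mu_eq_zero_of_finite_modP p (finite_modP_of_card_quotient_lt p m k hlt)

end Summit.BirchSwinnertonDyer.Rank1Residual.X5.TowerGap

/-! ## Part B — the O1 consumer at `p = 2` -/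

namespace Summit.BirchSwinnertonDyer.Rank1Residual.X5.O1

open Summit.BirchSwinnertonDyer.Rank1Residual.X5.TowerGap

variable (W : WeierstrassCurve ℚ) [W.IsElliptic] [W.IsGloballyMinimal]

/-- **K10 at the X-level — the TOWER-GAP certificate predicate at `2`** (lens-3 L3-10
`TowerGapMuCertificateAtTwo`, ROUTES-O1 §lens-3 GEN 4; o1 lead PLAN v2.5 C40): for every cyclotomic
datum `(κ, γ, D)` of `E` (globally minimal `W`) there are `m, k : ℕ` with ONE gap
`#(X/(2, T^{m+k})X) < 2^k · #(X/(2, T^m)X)`, `X = D.X = X(E/ℚ_∞)` (both quotients are finite,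
`finite_quotient_towerIdeal`; lens-3 uses `m = k = 2ⁿ`, `n ≤ 2`, where
`#(X/(2, T^{2ⁿ})X) = #(X/(2, ω_n)X) = 2^{d_n(E)}`). A per-curve COMPUTATIONAL hypothesis —
certificate / instrument tier (the P10 job computes `d_n(E) = dim_{𝔽₂} S_n^{Gr}(E)`; the support
S-G4.0 `exactLayerDescentAtTwo` identifying `S_n^{Gr}(E)` with `(X/2X)/ω_n`'s dual is RESERVED,
PLAN C44 (11), not typed here); EVIDENCE-carried per pair, never a Literature fact; nothing is
asserted. [cite: GreenbergLNM1716, §1 Conj. 1.11 and p. 136 l. 3 (the `n = 0` shadow `λ + μ ≥ dim X/𝔪X`)] -/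
def TowerGapAtTwo : Prop :=
  ∀ (κ : ZpExtension ℚ 2) (γ : Field.absoluteGaloisGroup ℚ), κ.IsCyclotomic →
    κ.IsTopGenerator γ → IsCyclotomicVariable 2 γ → ∀ D : W.SelmerDualData κ γ,
    ∃ m k : ℕ, Nat.card (D.X ⧸ (towerIdeal 2 (m + k) • ⊤ : Submodule (IwasawaAlgebra 2) D.X)) <
      2 ^ k * Nat.card (D.X ⧸ (towerIdeal 2 m • ⊤ : Submodule (IwasawaAlgebra 2) D.X))

omit [W.IsGloballyMinimal] in
/-- **T10 (PROVED): the tower-gap certificate gives `X(E/ℚ_∞)` torsion and `μ₂ = 0` for every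
cyclotomic datum** (`X` is finitely generated for an elliptic curve, `module_finite_holds`; then
`isTorsion_and_mu_eq_zero_of_card_quotient_lt`). No reduction hypothesis, no image hypothesis.
[cite: Washington1997, §13.2] [cite: GreenbergLNM1716, §1 (discussion after Thm. 1.3: `X` finitely generated)] -/
theorem isTorsion_and_mu_eq_zero_of_towerGapAtTwo (h : TowerGapAtTwo W)
    {κ : ZpExtension ℚ 2} {γ : Field.absoluteGaloisGroup ℚ} (hκ : κ.IsCyclotomic)
    (hγ : κ.IsTopGenerator γ) (hγ' : IsCyclotomicVariable 2 γ) (D : W.SelmerDualData κ γ) :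
    D.IsTorsion ∧ D.mu = 0 := by
  haveI : Module.Finite (IwasawaAlgebra 2) D.X := D.module_finite_holds hγ
  obtain ⟨m, k, hlt⟩ := h κ γ hκ hγ hγ' D
  exact isTorsion_and_mu_eq_zero_of_card_quotient_lt 2 m k hlt

/-- **U10 (PROVED): `MissingUpperBoundAt W 2` from the tower-gap certificate** on a rank-`0`
good-ordinary-`2` curve: `TowerGapAtTwo W` (`μ₂ = 0` for the cyclotomic data, T10) + the per-curve
Néron-integrality certificate `hint` (`ϖ · L₂(f, α) ∈ Λ`) ⇒ `ord₂ #Ш ≤ ord₂ #Ш_an` (SHARP), modulo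
the PUBLISHED inputs as hypotheses: Greenberg 4.1@2 (`hEC`), modularity (`hmod`), GZK (`hGZK`),
Kato 17.4 (1)(2)@2 (`h17`). Via `missingUpperBoundAt_two_of_mu_eq_zero`. No image hypothesis, no
period-unit input, no slack, no Cassels–Tate. [cite: Kato2004Asterisque, Thm. 17.4 (1)(2) (p. 273)]
[cite: GreenbergLNM1716, Thm. 4.1 (p. 102)] [cite: Miller2011LMS, Def. 1.1] -/
theorem missingUpperBoundAt_two_of_towerGap (hEC : TwoAdicEulerCharRankZero W 0)
    (hmod : nonempty_modularParametrizationData)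
    (hGZK : rank_eq_analyticRank_of_analyticRank_le_one)
    (h17 : ∀ [NeZero (W.conductorNorm ℤ)] (f : CuspForm (Gamma0 (W.conductorNorm ℤ)) 2),
      kato_divisibility_allPrimes W 2 (f := f))
    (hgap : TowerGapAtTwo W)
    (hint : ∀ [NeZero (W.conductorNorm ℤ)] (f : CuspForm (Gamma0 (W.conductorNorm ℤ)) 2),
      IsNewformOf W f → ∀ ϖ : ℚ, (ϖ : ℝ) * W.realPeriodRat = plusPeriod f →
        ∃ L₀ : IwasawaAlgebra 2, iwasawaToPowerSeries 2 L₀ =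
          PowerSeries.C (ϖ : ℚ_[2]) * padicLFunction f (unitRoot W 2 : ℚ_[2]))
    (hr : W.analyticRank = 0) (hgo : GoodOrd W 2) : MissingUpperBoundAt W 2 :=
  missingUpperBoundAt_two_of_mu_eq_zero W hEC hmod hGZK h17
    (fun _ _ hκ hγ hγ' D => (isTorsion_and_mu_eq_zero_of_towerGapAtTwo W hgap hκ hγ hγ' D).2)
    hint hr hgo

/-- **The residue-PAIR pipeline with no research crux (PROVED assembly, PLAN C43 (P1)).** On a
rank-`0` good-ordinary-`2` curve: tower-gap certificate (`hgap`) ∧ Néron-integrality certificate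
(`hint`) ∧ the lower half `MissingLowerBoundAt W 2` (`hlow`: per pair an exact `2^∞`-descent
certificate, ENGINE-I; per class the Eisenstein half at `2`) ⇒ `BSDp W 2`, modulo the published
inputs as hypotheses. What it does NOT buy: a class theorem (K10 is per curve; reach = the P10
job's answer); nothing on O1-B/C. Nothing is booked. [cite: Miller2011LMS, Def. 1.1 and §1] -/
theorem bsdp_two_of_towerGap_of_lowerBound (hEC : TwoAdicEulerCharRankZero W 0)
    (hmod : nonempty_modularParametrizationData)
    (hGZK : rank_eq_analyticRank_of_analyticRank_le_one)
    (h17 : ∀ [NeZero (W.conductorNorm ℤ)] (f : CuspForm (Gamma0 (W.conductorNorm ℤ)) 2),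
      kato_divisibility_allPrimes W 2 (f := f))
    (hgap : TowerGapAtTwo W)
    (hint : ∀ [NeZero (W.conductorNorm ℤ)] (f : CuspForm (Gamma0 (W.conductorNorm ℤ)) 2),
      IsNewformOf W f → ∀ ϖ : ℚ, (ϖ : ℝ) * W.realPeriodRat = plusPeriod f →
        ∃ L₀ : IwasawaAlgebra 2, iwasawaToPowerSeries 2 L₀ =
          PowerSeries.C (ϖ : ℚ_[2]) * padicLFunction f (unitRoot W 2 : ℚ_[2]))
    (hr : W.analyticRank = 0) (hgo : GoodOrd W 2) (hlow : MissingLowerBoundAt W 2) : BSDp W 2 :=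
  bsdp_two_of_mu_eq_zero_of_lowerBound W hEC hmod hGZK h17
    (fun _ _ hκ hγ hγ' D => (isTorsion_and_mu_eq_zero_of_towerGapAtTwo W hgap hκ hγ hγ' D).2)
    hint hr hgo hlow

/-- **The tower-gap certificate also FEEDS the refuter's upgrade at `k = 0`**: with Kato 17.4
(1)(2)@2 for the newform (`h17`) and an integral normaliser `ι L₀ = ϖ′ · L₂(f, α)`, `μ = 0`
(from `hgap`) gives `X` torsion and `L₀ ∈ char_Λ X` — i.e. the divisibility
`char_Λ X ∣ ϖ′ · L₂(f, α)` in `Λ` (`MuZeroUpgrade.charIdeal_dvd_of_kato_allPrimes_of_mu_eq_zero`),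
the `k = 0` face of F3. [cite: Kato2004Asterisque, Thm. 17.4 (1)(2) (p. 273)] -/
theorem charIdeal_dvd_of_towerGap (hgap : TowerGapAtTwo W) (hord : IsOrdinaryAt W 2)
    {κ : ZpExtension ℚ 2} {γ : Field.absoluteGaloisGroup ℚ} {N : ℕ} [NeZero N]
    {f : CuspForm (Gamma0 N) 2} (h17 : kato_divisibility_allPrimes W 2 (f := f))
    (hκ : κ.IsCyclotomic) (hγ : κ.IsTopGenerator γ) (hγ' : IsCyclotomicVariable 2 γ)
    (hf : IsNewformOf W f) (D : W.SelmerDualData κ γ) {ϖ' : ℚ} {L₀ : IwasawaAlgebra 2}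
    (hL₀ : iwasawaToPowerSeries 2 L₀ =
      PowerSeries.C (ϖ' : ℚ_[2]) * padicLFunction f (unitRoot W 2 : ℚ_[2])) :
    D.IsTorsion ∧ L₀ ∈ D.charIdeal :=
  MuZeroUpgrade.charIdeal_dvd_of_kato_allPrimes_of_mu_eq_zero W 2 h17 hκ hγ hγ' hord hf D
    (isTorsion_and_mu_eq_zero_of_towerGapAtTwo W hgap hκ hγ hγ' D).2 hL₀

end Summit.BirchSwinnertonDyer.Rank1Residual.X5.O1
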